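import Summits.CriticalPhenomena.PercolationContinuityZ3.Theorems.PercNearOneGluingNoHeavyLowerTailSahiSlotPairConeLiftCert

/-!
# The DIAGONAL two-level identity: `sStarD (D × {1,2}) B C = 2·(sStarD D B₁ C₁ + sStarD D B₂ C₂) + remTwoDiag` (every dimension)

Support file of the one-cut programme (crux `NoHeavyLowerTail`, stmt-CriticalPhenomena-4575; cell `prim-masterthm`, seat P3, gen 23;
`run/shared/lean/prim/prim-masterthm/prim-masterthm-p3/HIERARCHY.md` §31, memo `FROM-prim-masterthm-p3-g23-FORMAT-LIFTS.md` §3(iv)).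

A SECOND exact identity for the two-level lift, found by the typed-atom LP of gen 23 (`code-g23/tdident.py`): only the two DIAGONAL slice
forms `sStarD D B₁ C₁`, `sStarD D B₂ C₂` are borrowed (coefficient `2` each), the remainder `remTwoDiag` again being ten explicit pair-cone terms
(fibre-Kleitman with vertical increments, point × vertical increment, opposite increment × increment — no diagonal term).  Compared with
`sStarD_liftTwo_eq` (`…SahiSlotPairConeLifts`) it says `remTwo − remTwoDiag = (cross slices) − (diagonal slices)`, i.e. the pinned form of `D` on the
vertical INCREMENTS, `M_D(1_{B₂} − 1_{B₁}, 1_{C₂} − 1_{C₁})`, is dominated in `C ⊗ C` by the two-level remainder.  Consequence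
`PinnedGood.liftTwo_diag`: the format lift `D ↦ D × {1,2}` needs only the diagonal placements of the base certificate.
HONEST LABEL: exact bookkeeping identity; no open cell changes status.  Pure, standard axioms. [this work]
-/

noncomputable section

namespace Summit.CriticalPhenomena.PercolationContinuityZ3.Theorems

open Finset Function
open Literature.Combinatorics.Sahi2008

namespace SahiSlot

open SahiGridPattern SahiGrid3

variable {n : ℕ}

/-- The remainder of the diagonal two-level identity (ten terms; no diagonal `Dg` term). [this work] -/
def remTwoDiag (D : Finset (Pd n)) (B C : Finset (Pd (n + 1))) : ℤ :=
  (Nf (ind (sl B 1) - ind (sl B 0)) (ind D) (ind (sl C 1)) - Lf (ind D) (ind (sl B 1) - ind (sl B 0)) (ind (sl C 1)))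
  + (Nf (ind (sl B 2) - ind (sl B 0)) (ind D) (ind (sl C 2)) - Lf (ind D) (ind (sl B 2) - ind (sl B 0)) (ind (sl C 2)))
  + (Nf (ind (sl C 1) - ind (sl C 0)) (ind D) (ind (sl B 1)) - Lf (ind D) (ind (sl B 1)) (ind (sl C 1) - ind (sl C 0)))
  + (Nf (ind (sl C 2) - ind (sl C 0)) (ind D) (ind (sl B 2)) - Lf (ind D) (ind (sl B 2)) (ind (sl C 2) - ind (sl C 0)))
  + Nf (ind D) (ind (sl B 0)) (ind (sl C 1) - ind (sl C 0)) + Nf (ind D) (ind (sl B 0)) (ind (sl C 2) - ind (sl C 0))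
  + Nf (ind D) (ind (sl B 1) - ind (sl B 0)) (ind (sl C 1)) + Nf (ind D) (ind (sl B 2) - ind (sl B 0)) (ind (sl C 2))
  + Nf (ind (sl B 2) - ind (sl B 1)) (ind D) (ind (sl C 2) - ind (sl C 1))
  + Nf (ind (sl C 2) - ind (sl C 1)) (ind D) (ind (sl B 2) - ind (sl B 1))

/-- **THE DIAGONAL TWO-LEVEL IDENTITY** (every `n`, all finsets): `sStarD (D × {1,2}) B C = 2·(sStarD D B₁ C₁ + sStarD D B₂ C₂) + remTwoDiag D B C` —
only the two DIAGONAL slices of the base are borrowed (found by the typed-algebra LP of gen 23, `tdident.py`; equivalently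
`remTwo − remTwoDiag = M_D(1_{B₂} − 1_{B₁}, 1_{C₂} − 1_{C₁}) − sStarD D B₁ C₂ − sStarD D B₂ C₁ + …`, see the memo). [this work] -/
theorem sStarD_liftTwo_eq_diag (D : Finset (Pd n)) (B C : Finset (Pd (n + 1))) :
    sStarD (liftTwo D) B C = 2 * (sStarD D (sl B 1) (sl C 1) + sStarD D (sl B 2) (sl C 2)) + remTwoDiag D B C := by
  rw [sStarD_eq_sum_ind]
  simp only [sum_snoc, Fin.sum_univ_three, ind_sl, sl_liftTwo_zero, sl_liftTwo_one, sl_liftTwo_two, ind_empty_eq, zero_mul,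
    Finset.sum_const_zero, zero_add, Finset.sum_add_distrib]
  rw [block_eq_atoms, block_eq_atoms, block_eq_atoms, block_eq_atoms, block_eq_atoms, block_eq_atoms, block_eq_atoms, block_eq_atoms,
    block_eq_atoms, block_eq_atoms, block_eq_atoms, block_eq_atoms, block_eq_atoms, block_eq_atoms, block_eq_atoms, block_eq_atoms,
    block_eq_atoms, block_eq_atoms]
  obtain ⟨h0, h1, h2, h3, h4, h5, h6, h7, h8, h9, h10, h11, h12, h13, h14, h15, h16, h17, h18, h19, h20, h21, h22, h23, h24, h25, h26, h27, h28, h29, h30, h31, h32, h33, h34, h35, h36, h37, h38, h39, h40, h41, h42, h43, h44, h45, h46, h47, h48, h49, h50, h51, h52, h53, h54, h55, h56, h57, h58, h59⟩ := c_vals_liftTwo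
  simp only [h0, h1, h2, h3, h4, h5, h6, h7, h8, h9, h10, h11, h12, h13, h14, h15, h16, h17, h18, h19, h20, h21, h22, h23, h24, h25, h26, h27, h28, h29, h30, h31, h32, h33, h34, h35, h36, h37, h38, h39, h40, h41, h42, h43, h44, h45, h46, h47, h48, h49, h50, h51, h52, h53, h54, h55, h56, h57, h58, h59]
  rw [sStarD_counting_atoms, sStarD_counting_atoms]
  simp only [remTwoDiag, Nf_sub₁, Nf_sub₂, Nf_sub₃, Lf_sub₂, Lf_sub₃]
  ring

/-- The diagonal two-level remainder is in the pair cone (for an up-set `D`). [this work] -/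
theorem remTwoDiag_inPairCone {D : Finset (Pd n)} (hD : IsUpperSet (D : Set (Pd n))) :
    InPairCone (n + 1) (fun B C => (remTwoDiag D B C : ℝ)) := by
  have h01 : (0:Fin 3) ≤ 1 := by decide
  have h02 : (0:Fin 3) ≤ 2 := by decide
  have h12 : (1:Fin 3) ≤ 2 := by decide
  refine ((((((((((inPairCone_Kb hD h01 1).add (inPairCone_Kb hD h02 2)).add (inPairCone_Kc hD h01 1)).add (inPairCone_Kc hD h02 2)).add
    (inPairCone_PV D 0 h01)).add (inPairCone_PV D 0 h02)).add (inPairCone_VP D h01 1)).add (inPairCone_VP D h02 2)).add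
    (inPairCone_VVb D h12 h12)).add (inPairCone_VVc D h12 h12)).congr fun B C _ _ => ?_
  unfold remTwoDiag
  push_cast
  ring

/-- **The two-level lift from the DIAGONAL slice certificates alone**: a pair-cone certificate for `(B,C) ↦ sStarD D B C` yields one for
`D × {1,2}` using only its placements on the layer pairs `(1,1)` and `(2,2)`. [this work] -/
theorem PinnedGood.liftTwo_diag {D : Finset (Pd n)} (hD : IsUpperSet (D : Set (Pd n))) (h : PinnedGood n D) :
    PinnedGood (n + 1) (SahiSlot.liftTwo D) := by
  refine ((((h.slices 1 1).add (h.slices 2 2)).smul (by norm_num : (0:ℝ) ≤ 2)).add (remTwoDiag_inPairCone hD)).congr fun B C _ _ => ?_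
  rw [sStarD_liftTwo_eq_diag]; push_cast; ring

end SahiSlot

end Summit.CriticalPhenomena.PercolationContinuityZ3.Theorems
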